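import Mathlib
import Summits.NavierStokesRegularity.FluidComputer.AbcInertiaCITailPairing
import Summits.NavierStokesRegularity.FluidComputer.AbcInertiaCIHeadForm
import Summits.NavierStokesRegularity.FluidComputer.InertiaJunctionSquare

/-!
# INERTIA-3L instantiation — CLASS I twin, Part 4: the weighted form is NEGATIVE on every non-zero coefficient
# vector of the graph domain (instab3 g8, 2026-08-27; the class-II file `AbcInertiaForm` with cert-3 g9's
# `AbcClassI` layer — statements and proofs identical up to the layer; see that file's docstring)

HONEST FRAMING (D-0035): not a claim about Navier–Stokes. WHAT THIS IS NOT: not NS evidence; MODEL lane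
(forced-ABC linearisation, CLASS I). `re_tsum_weighted_form_neg`: (R1) + (R3) + (R4) ⇒
`Re Σ' conj((G w)_i)((L − a) w)_i < 0` for every `w ≠ 0` with `Σ(1+|O_i|²)|w_i|² < ∞` — hypothesis (L⁻) of
`LyapunovInertiaCount.finrank_le_of_generator_form_neg` for the class-I coordinate operator.
Mathlib + `AbcInertiaCITailPairing` + `AbcInertiaCIHeadForm` + `InertiaJunctionSquare`; no new definitions;
std axioms. [folklore]
-/

noncomputable section

open scoped BigOperators ComplexConjugate Matrix
open Finset Matrix

namespace Summit.NavierStokesRegularity.FluidComputer.AbcInertiaCI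

open Literature.Analysis.FunctionSpaces Literature.Analysis.FunctionSpaces.Torus
open Literature.Analysis.FluidPDE
open Summit.NavierStokesRegularity.FluidComputer.AbcClassI
open Summit.NavierStokesRegularity.FluidComputer.AbcClassII (Fam crossForm secOp rotR rotS sgnAct sgnOrbit
  cube extend restrictTo extend_add extend_smul extend_zero rotR_add rotR_smul rotS_add rotS_smul
  crossForm_add crossForm_smul secOp_add secOp_smul restrictTo_add restrictTo_smul Orbit toOrbit onormSq
  osupNorm cubeOrbits nbrOrbits mem_sgnOrbit mem_sgnOrbit_self card_sgnOrbit_le sgnOrbit_eq_of_mem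
  mem_sgnOrbit_comm sgnOrbit_eq_or_disjoint neg_mem_sgnOrbit neg_self_mem_sgnOrbit rotFreqR_mem_sgnOrbit
  rotFreqS_mem_sgnOrbit freqNormSq_eq_of_mem_sgnOrbit supNorm_eq_of_mem_sgnOrbit mem_cube
  mem_cube_iff_supNorm cube_mono sgnOrbit_subset_cube zero_not_mem_sgnOrbit ne_zero_of_mem_sgnOrbit
  toOrbit_val toOrbit_eq_iff mem_cubeOrbits mem_nbrOrbits mem_nbrOrbits_comm card_nbrOrbits_le rotR_apply
  rotS_apply freqNormSq_rotFreq secOp_conj isConjSymm_secOp kdot_secOp mem_iff_of_orbitClosed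
  isConjSymm_cut kdot_cut orbitClosed_cube_ne_zero orbitClosed_shell neg_mem_of_orbitClosed
  isConjSymm_lerayCrossForm kdot_conj conj_eq_zero_of_not_mem linOp_zero_eq conj_theta_neg
  extend_apply_of_mem extend_apply_of_not_mem restrictTo_extend extend_restrictTo extend_sum
  inner_eq_sum_extend inner_conjVec_conjVec conj_sum_inner_of_isConjSymm sum_inner_eq_re_of_isConjSymm
  real_inner_eq_re real_smul_eq norm_lerayCrossForm_le sobolevWeight_one_eq cube_filter_eq_biUnion sum_cube_filter_eq
  onormSq_nonneg)

/-! ### §1 Weighted summability tools -/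

/-- A series `c_i ‖w_i‖²` with `|c_i| ≤ K (1 + |O_i|²)` is summable on the graph class. -/
theorem summable_coef_mul_norm_sq {w : AbcClassI.Idx → ℂ} (hw : Summable fun i : AbcClassI.Idx => (1 + onormSq i.1) * ‖w i‖ ^ 2)
    (c : AbcClassI.Idx → ℝ) (K : ℝ) (hc : ∀ i, |c i| ≤ K * (1 + onormSq i.1)) :
    Summable fun i : AbcClassI.Idx => c i * ‖w i‖ ^ 2 := by
  refine Summable.of_norm_bounded (g := fun i => K * ((1 + onormSq i.1) * ‖w i‖ ^ 2)) (hw.mul_left K)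
    fun i => ?_
  rw [Real.norm_eq_abs, abs_mul, abs_of_nonneg (sq_nonneg ‖w i‖)]
  have := mul_le_mul_of_nonneg_right (hc i) (sq_nonneg ‖w i‖)
  linarith

/-- The complex series `conj(w_i) · c_i · w_i` with `|c_i| ≤ K (1 + |O_i|²)` is summable on the graph class. -/
theorem summable_conj_coef_mul {w : AbcClassI.Idx → ℂ} (hw : Summable fun i : AbcClassI.Idx => (1 + onormSq i.1) * ‖w i‖ ^ 2)
    (c : AbcClassI.Idx → ℝ) (K : ℝ) (hc : ∀ i, |c i| ≤ K * (1 + onormSq i.1)) :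
    Summable fun i : AbcClassI.Idx => (starRingEnd ℂ) (w i) * (((c i : ℝ) : ℂ) * w i) := by
  refine Summable.of_norm_bounded (g := fun i => K * ((1 + onormSq i.1) * ‖w i‖ ^ 2)) (hw.mul_left K)
    fun i => ?_
  rw [norm_mul, norm_mul, Complex.norm_conj, Complex.norm_real, Real.norm_eq_abs]
  have := mul_le_mul_of_nonneg_right (hc i) (sq_nonneg ‖w i‖)
  nlinarith [norm_nonneg (w i), abs_nonneg (c i)]

/-- Coefficient bound: `|−|O|²/R − a| ≤ (1/R + |a|)(1 + |O|²)`. -/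
theorem abs_diag_coef_le {R : ℝ} (hR : 0 < R) (a : ℝ) (i : AbcClassI.Idx) :
    |-(onormSq i.1 / R) - a| ≤ (1 / R + |a|) * (1 + onormSq i.1) := by
  have hq := onormSq_nonneg i.1
  have h1 : |-(onormSq i.1 / R) - a| ≤ onormSq i.1 / R + |a| := by
    calc |-(onormSq i.1 / R) - a| = |-(onormSq i.1 / R + a)| := by ring_nf
      _ = |onormSq i.1 / R + a| := abs_neg _
      _ ≤ |onormSq i.1 / R| + |a| := abs_add_le _ _
      _ = onormSq i.1 / R + |a| := by rw [abs_of_nonneg (div_nonneg hq hR.le)]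
  have h2 : onormSq i.1 / R ≤ 1 / R * (1 + onormSq i.1) := by
    rw [div_eq_mul_one_div, mul_comm]
    exact mul_le_mul_of_nonneg_left (by linarith) (by positivity)
  nlinarith [abs_nonneg a]

/-- Coefficient bound: `||O|²/R + a − √2| ≤ (1/R + |a| + 2)(1 + |O|²)`. -/
theorem abs_tail_coef_le {R : ℝ} (hR : 0 < R) (a : ℝ) (i : AbcClassI.Idx) :
    |onormSq i.1 / R + a - Real.sqrt 2| ≤ (1 / R + |a| + 2) * (1 + onormSq i.1) := by
  have hq := onormSq_nonneg i.1
  have hs2 : Real.sqrt 2 ≤ 2 := by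
    rw [show (2 : ℝ) = Real.sqrt 4 by rw [show (4:ℝ) = 2 ^ 2 by norm_num, Real.sqrt_sq (by norm_num)]]
    exact Real.sqrt_le_sqrt (by norm_num)
  have h1 : |onormSq i.1 / R + a - Real.sqrt 2| ≤ onormSq i.1 / R + |a| + 2 := by
    calc |onormSq i.1 / R + a - Real.sqrt 2| ≤ |onormSq i.1 / R + a| + |Real.sqrt 2| := abs_sub _ _
      _ ≤ (|onormSq i.1 / R| + |a|) + |Real.sqrt 2| := by gcongr; exact abs_add_le _ _
      _ = onormSq i.1 / R + |a| + Real.sqrt 2 := by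
          rw [abs_of_nonneg (div_nonneg hq hR.le), abs_of_nonneg (Real.sqrt_nonneg _)]
      _ ≤ onormSq i.1 / R + |a| + 2 := by linarith
  have h2 : onormSq i.1 / R ≤ 1 / R * (1 + onormSq i.1) := by
    rw [div_eq_mul_one_div, mul_comm]
    exact mul_le_mul_of_nonneg_left (by linarith) (by positivity)
  nlinarith [abs_nonneg a]

/-! ### §2 The pointwise split of the weighted form and the tail pieces -/

section Form

variable {R a rL rH : ℝ} (hR : 0 < R) (h0 : 0 ≤ rL) (hLH : rL + 1 ≤ rH)
variable {HL HH HB : Finset AbcClassI.Idx}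
variable (hHL : ∀ i : AbcClassI.Idx, i ∈ HL ↔ onormSq i.1 ≤ rL ^ 2)
variable (hHH : ∀ i : AbcClassI.Idx, i ∈ HH ↔ onormSq i.1 ≤ rH ^ 2)
variable (hHB : ∀ i : AbcClassI.Idx, i ∈ HB ↔ rH ^ 2 < onormSq i.1 ∧ onormSq i.1 ≤ (rH + 1) ^ 2)
variable (hR3 : ∀ i : AbcClassI.Idx, i ∉ HH → 0 < onormSq i.1 / R + a - Real.sqrt 2)
variable (GH : Matrix ↥HH ↥HH ℝ)

/-- **Pointwise split.** With the tail vector `y = 𝟙_{∉H} w` and the head vector `𝟙_H w`: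
`conj((Gw)_i)((L−a)w)_i = 𝟙_H(i)·(same) + conj(y_i)(−|O_i|²/R − a) y_i + conj(y_i) Σ_j AbcClassI.amat i j (𝟙_H w)_j
 + conj(y_i) Σ_j AbcClassI.amat i j y_j`. -/
theorem weighted_form_pointwise (w : AbcClassI.Idx → ℂ) (i : AbcClassI.Idx) :
    (starRingEnd ℂ) (if h : i ∈ HH then ∑ j : ↥HH, ((GH ⟨i, h⟩ j : ℝ) : ℂ) * w j.1 else w i) *
        (((-(onormSq i.1 / R) : ℝ) : ℂ) * w i + ∑ j ∈ AbcClassI.nbrIdx i, ((AbcClassI.amat i j : ℝ) : ℂ) * w j -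
          ((a : ℝ) : ℂ) * w i) =
      (if i ∈ HH then (starRingEnd ℂ) (if h : i ∈ HH then ∑ j : ↥HH, ((GH ⟨i, h⟩ j : ℝ) : ℂ) * w j.1 else w i) *
          (((-(onormSq i.1 / R) : ℝ) : ℂ) * w i + ∑ j ∈ AbcClassI.nbrIdx i, ((AbcClassI.amat i j : ℝ) : ℂ) * w j -
            ((a : ℝ) : ℂ) * w i) else 0) +
      (starRingEnd ℂ) (if i ∈ HH then 0 else w i) *
          ((((-(onormSq i.1 / R) - a) : ℝ) : ℂ) * (if i ∈ HH then 0 else w i)) +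
      (starRingEnd ℂ) (if i ∈ HH then 0 else w i) *
          ∑ j ∈ AbcClassI.nbrIdx i, ((AbcClassI.amat i j : ℝ) : ℂ) * (if j ∈ HH then w j else 0) +
      (starRingEnd ℂ) (if i ∈ HH then 0 else w i) *
          ∑ j ∈ AbcClassI.nbrIdx i, ((AbcClassI.amat i j : ℝ) : ℂ) * (if j ∈ HH then 0 else w j) := by
  by_cases hi : i ∈ HH
  · simp only [hi, dif_pos, if_true, map_zero, zero_mul, add_zero]
  · simp only [hi, dif_neg, if_false, not_false_eq_true]
    have hrow : ∑ j ∈ AbcClassI.nbrIdx i, ((AbcClassI.amat i j : ℝ) : ℂ) * w j =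
        ∑ j ∈ AbcClassI.nbrIdx i, ((AbcClassI.amat i j : ℝ) : ℂ) * (if j ∈ HH then w j else 0) +
          ∑ j ∈ AbcClassI.nbrIdx i, ((AbcClassI.amat i j : ℝ) : ℂ) * (if j ∈ HH then 0 else w j) := by
      rw [← Finset.sum_add_distrib]
      refine Finset.sum_congr rfl fun j _ => ?_
      by_cases hj : j ∈ HH <;> simp [hj]
    rw [hrow]
    push_cast
    ring

include hHL hHH hHB h0 hLH in
/-- **The cross piece is supported on `B`**: off `B`, `conj(y_i) Σ_j AbcClassI.amat i j (𝟙_H w)_j = 0`. -/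
theorem cross_piece_eq_zero (w : AbcClassI.Idx → ℂ) {i : AbcClassI.Idx} (hi : i ∉ HB) :
    (starRingEnd ℂ) (if i ∈ HH then 0 else w i) *
        ∑ j ∈ AbcClassI.nbrIdx i, ((AbcClassI.amat i j : ℝ) : ℂ) * (if j ∈ HH then w j else 0) = 0 := by
  by_cases hiH : i ∈ HH
  · rw [if_pos hiH, map_zero, zero_mul]
  · rw [Finset.sum_eq_zero, mul_zero]
    intro j hj
    by_cases hjH : j ∈ HH
    · exact absurd (mem_HB_of_not_mem_HH h0 hLH hHL hHH hHB hiH hj hjH).1 hi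
    · rw [if_neg hjH, mul_zero]

include hHH hHB in
/-- **The cross piece on `B`**: for `i ∈ B`, it is `conj(w_i) Σ_{j ∈ H} AbcClassI.amat i j w_j`. -/
theorem cross_piece_of_mem_HB (w : AbcClassI.Idx → ℂ) {i : AbcClassI.Idx} (hi : i ∈ HB) :
    (starRingEnd ℂ) (if i ∈ HH then 0 else w i) *
        ∑ j ∈ AbcClassI.nbrIdx i, ((AbcClassI.amat i j : ℝ) : ℂ) * (if j ∈ HH then w j else 0) =
      (starRingEnd ℂ) (w i) * ∑ j ∈ HH, ((AbcClassI.amat i j : ℝ) : ℂ) * w j := by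
  rw [if_neg (not_mem_HH_of_mem_HB hHH hHB hi), rowSum_indicator_eq w i]

/-- The tail vector lies in the graph class. -/
theorem summable_tail {w : AbcClassI.Idx → ℂ} (hw : Summable fun i : AbcClassI.Idx => (1 + onormSq i.1) * ‖w i‖ ^ 2) :
    Summable fun i : AbcClassI.Idx => (1 + onormSq i.1) * ‖(if i ∈ HH then 0 else w i)‖ ^ 2 := by
  refine Summable.of_nonneg_of_le (fun i => mul_nonneg (by linarith [onormSq_nonneg i.1]) (sq_nonneg _))
    (fun i => ?_) hw
  by_cases hi : i ∈ HH <;> simp [hi]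
  exact mul_nonneg (by linarith [onormSq_nonneg i.1]) (sq_nonneg _)

include hR in
/-- **The diagonal tail piece**: summable, with real part `−Σ' (|O_i|²/R + a) |y_i|²`. -/
theorem diag_piece {w : AbcClassI.Idx → ℂ} (hw : Summable fun i : AbcClassI.Idx => (1 + onormSq i.1) * ‖w i‖ ^ 2) :
    Summable (fun i : AbcClassI.Idx => (starRingEnd ℂ) (if i ∈ HH then 0 else w i) *
        ((((-(onormSq i.1 / R) - a) : ℝ) : ℂ) * (if i ∈ HH then 0 else w i))) ∧
      (∑' i : AbcClassI.Idx, (starRingEnd ℂ) (if i ∈ HH then 0 else w i) *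
          ((((-(onormSq i.1 / R) - a) : ℝ) : ℂ) * (if i ∈ HH then 0 else w i))).re =
        -∑' i : AbcClassI.Idx, (onormSq i.1 / R + a) * ‖(if i ∈ HH then 0 else w i)‖ ^ 2 := by
  have hy := summable_tail (HH := HH) hw
  have hs := summable_conj_coef_mul hy (fun i => -(onormSq i.1 / R) - a) (1 / R + |a|)
    (fun i => abs_diag_coef_le hR a i)
  refine ⟨hs, ?_⟩
  rw [Complex.re_tsum hs]
  have e : ∀ i : AbcClassI.Idx, ((starRingEnd ℂ) (if i ∈ HH then 0 else w i) *
      ((((-(onormSq i.1 / R) - a) : ℝ) : ℂ) * (if i ∈ HH then 0 else w i))).re =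
      -((onormSq i.1 / R + a) * ‖(if i ∈ HH then 0 else w i)‖ ^ 2) := by
    intro i
    rw [AbcInertia.re_conj_mul_ofReal_mul]; ring
  rw [tsum_congr e, tsum_neg]

/-! ### §3 Strict negativity of the weighted form -/

variable (Ah : Matrix ↥HH ↥HH ℝ) (AHB : Matrix ↥HH ↥HB ℝ) (ABH : Matrix ↥HB ↥HH ℝ) (E : ↥HB → ℝ)
variable (hGH : GHᵀ = GH)
variable (hAh : Ah = Matrix.of fun i j : ↥HH =>
  (if i = j then -(onormSq i.1.1 / R) - a else 0) + AbcClassI.amat i.1 j.1)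
variable (hAHB : AHB = Matrix.of fun (i : ↥HH) (l : ↥HB) => AbcClassI.amat i.1 l.1)
variable (hABH : ABH = Matrix.of fun (l : ↥HB) (i : ↥HH) => AbcClassI.amat l.1 i.1)
variable (hE : E = fun l : ↥HB => onormSq l.1.1 / R + a - Real.sqrt 2)
variable (hR1 : ∀ x : ↥HH → ℝ, x ≠ 0 →
  x ⬝ᵥ ((GH * Ah + Ahᵀ * GH + (1 / 2 : ℝ) • ((GH * AHB + ABHᵀ) * Matrix.diagonal (fun l => (E l)⁻¹) *
    (GH * AHB + ABHᵀ)ᵀ)) *ᵥ x) < 0)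

include hHH hHB hR3 hE hR1 in
/-- The junction bracket `x ⬝ (M₀ x) + 2 x ⬝ (F₂ y) − 2 Σ E_l y_l²` is `≤ 0`, and `< 0` off the origin
(`InertiaJunctionSquare.head_boundary_form_neg` with (R1), (R3)). -/
theorem bracket_nonpos (x : ↥(HH : Finset AbcClassI.Idx) → ℝ) (yv : ↥(HB : Finset AbcClassI.Idx) → ℝ) :
    x ⬝ᵥ ((GH * Ah + Ahᵀ * GH) *ᵥ x) + 2 * (x ⬝ᵥ ((GH * AHB + ABHᵀ) *ᵥ yv)) - 2 * ∑ l, E l * yv l ^ 2 ≤ 0 ∧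
      ((x ≠ 0 ∨ yv ≠ 0) →
        x ⬝ᵥ ((GH * Ah + Ahᵀ * GH) *ᵥ x) + 2 * (x ⬝ᵥ ((GH * AHB + ABHᵀ) *ᵥ yv)) - 2 * ∑ l, E l * yv l ^ 2 < 0) := by
  have hEpos : ∀ l : ↥HB, 0 < E l := by
    intro l; rw [hE]; exact hR3 l.1 (not_mem_HH_of_mem_HB hHH hHB l.2)
  have hstrict : (x ≠ 0 ∨ yv ≠ 0) →
      x ⬝ᵥ ((GH * Ah + Ahᵀ * GH) *ᵥ x) + 2 * (x ⬝ᵥ ((GH * AHB + ABHᵀ) *ᵥ yv)) - 2 * ∑ l, E l * yv l ^ 2 < 0 :=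
    fun h => InertiaJunctionSquare.head_boundary_form_neg (GH * Ah + Ahᵀ * GH) (GH * AHB + ABHᵀ) E hEpos
      hR1 x yv h
  refine ⟨?_, hstrict⟩
  by_cases h : x ≠ 0 ∨ yv ≠ 0
  · exact (hstrict h).le
  · push Not at h
    obtain ⟨rfl, rfl⟩ := h
    simp

include hR h0 hLH hHL hHH hHB hR3 hGH hAh hAHB hABH hE hR1 in
/-- **(L⁻) FOR THE CLASS-II OPERATOR.** For every `w : AbcClassI.Idx → ℂ` in the graph class with `w ≠ 0`:
`Re Σ'_i conj((G w)_i) ((L − a) w)_i < 0`, and the series is summable. -/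
theorem re_tsum_weighted_form_neg (w : AbcClassI.Idx → ℂ)
    (hw : Summable fun i : AbcClassI.Idx => (1 + onormSq i.1) * ‖w i‖ ^ 2) (hw0 : w ≠ 0) :
    Summable (fun i : AbcClassI.Idx =>
      (starRingEnd ℂ) (if h : i ∈ HH then ∑ j : ↥HH, ((GH ⟨i, h⟩ j : ℝ) : ℂ) * w j.1 else w i) *
        (((-(onormSq i.1 / R) : ℝ) : ℂ) * w i + ∑ j ∈ AbcClassI.nbrIdx i, ((AbcClassI.amat i j : ℝ) : ℂ) * w j -
          ((a : ℝ) : ℂ) * w i)) ∧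
    (∑' i : AbcClassI.Idx,
      (starRingEnd ℂ) (if h : i ∈ HH then ∑ j : ↥HH, ((GH ⟨i, h⟩ j : ℝ) : ℂ) * w j.1 else w i) *
        (((-(onormSq i.1 / R) : ℝ) : ℂ) * w i + ∑ j ∈ AbcClassI.nbrIdx i, ((AbcClassI.amat i j : ℝ) : ℂ) * w j -
          ((a : ℝ) : ℂ) * w i)).re < 0 := by
  classical
  -- names for the four pieces
  set f : AbcClassI.Idx → ℂ := fun i =>
    (starRingEnd ℂ) (if h : i ∈ HH then ∑ j : ↥HH, ((GH ⟨i, h⟩ j : ℝ) : ℂ) * w j.1 else w i) *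
      (((-(onormSq i.1 / R) : ℝ) : ℂ) * w i + ∑ j ∈ AbcClassI.nbrIdx i, ((AbcClassI.amat i j : ℝ) : ℂ) * w j -
        ((a : ℝ) : ℂ) * w i) with hf
  set y : AbcClassI.Idx → ℂ := fun i => if i ∈ HH then 0 else w i with hydef
  set fH : AbcClassI.Idx → ℂ := fun i => if i ∈ HH then f i else 0 with hfH
  set f1 : AbcClassI.Idx → ℂ := fun i => (starRingEnd ℂ) (y i) * ((((-(onormSq i.1 / R) - a) : ℝ) : ℂ) * y i) with hf1
  set f2 : AbcClassI.Idx → ℂ := fun i => (starRingEnd ℂ) (y i) *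
    ∑ j ∈ AbcClassI.nbrIdx i, ((AbcClassI.amat i j : ℝ) : ℂ) * (if j ∈ HH then w j else 0) with hf2
  set f3 : AbcClassI.Idx → ℂ := fun i => (starRingEnd ℂ) (y i) * ∑ j ∈ AbcClassI.nbrIdx i, ((AbcClassI.amat i j : ℝ) : ℂ) * y j with hf3
  have hsplit : ∀ i, f i = fH i + f1 i + f2 i + f3 i := fun i =>
    weighted_form_pointwise (R := R) (a := a) GH w i
  -- summability of the pieces
  have hy : Summable fun i : AbcClassI.Idx => (1 + onormSq i.1) * ‖y i‖ ^ 2 := summable_tail (HH := HH) hw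
  have hfH_supp : ∀ i ∉ HH, fH i = 0 := fun i hi => by simp only [hfH, if_neg hi]
  have hfH_s : Summable fH := summable_of_ne_finset_zero hfH_supp
  obtain ⟨hf1_s, hf1_re⟩ := diag_piece (R := R) (a := a) (HH := HH) hR hw
  have hf2_supp : ∀ i ∉ HB, f2 i = 0 := fun i hi => cross_piece_eq_zero h0 hLH hHL hHH hHB w hi
  have hf2_s : Summable f2 := summable_of_ne_finset_zero hf2_supp
  have hf3_s : Summable f3 := summable_pairing hy
  have hfs : Summable f := by
    have : f = fun i => fH i + f1 i + f2 i + f3 i := funext hsplit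
    rw [this]
    exact ((hfH_s.add hf1_s).add hf2_s).add hf3_s
  refine ⟨hfs, ?_⟩
  -- the tsum splits
  have htsum : ∑' i, f i = ∑ i ∈ HH, f i + ∑' i, f1 i + ∑ i ∈ HB, f2 i + ∑' i, f3 i := by
    have e1 : ∑' i, f i = ∑' i, (fH i + f1 i + f2 i + f3 i) := tsum_congr hsplit
    rw [e1, ((hfH_s.add hf1_s).add hf2_s).tsum_add hf3_s, (hfH_s.add hf1_s).tsum_add hf2_s,
      hfH_s.tsum_add hf1_s, tsum_eq_sum hfH_supp, tsum_eq_sum hf2_supp]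
    congr 3
    exact Finset.sum_congr rfl fun i hi => by simp only [hfH, if_pos hi]
  -- the head and cross pieces as Fintype sums, then the head identity
  have hheadF : ∑ i ∈ HH, f i = ∑ i : ↥HH, (starRingEnd ℂ) (∑ j : ↥HH, ((GH i j : ℝ) : ℂ) * w j.1) *
      (((-(onormSq i.1.1 / R) : ℝ) : ℂ) * w i.1 + ∑ j ∈ AbcClassI.nbrIdx i.1, ((AbcClassI.amat i.1 j : ℝ) : ℂ) * w j -
        ((a : ℝ) : ℂ) * w i.1) := by
    rw [← Finset.sum_coe_sort HH]
    refine Finset.sum_congr rfl fun i _ => ?_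
    simp only [hf, dif_pos i.2]
  have hcrossF : ∑ i ∈ HB, f2 i = ∑ i : ↥HB, (starRingEnd ℂ) (w i.1) * ∑ j ∈ HH, ((AbcClassI.amat i.1 j : ℝ) : ℂ) * w j := by
    rw [← Finset.sum_coe_sort HB]
    refine Finset.sum_congr rfl fun i _ => ?_
    exact cross_piece_of_mem_HB hHH hHB w i.2
  have hhead := two_mul_re_head_eq h0 hLH hHH hHB GH Ah AHB ABH hGH hAh hAHB hABH w
  rw [← hheadF, ← hcrossF] at hhead
  -- the tail pairing bound and the diagonal piece
  have hf3_re : (∑' i, f3 i).re ≤ Real.sqrt 2 * ∑' i, ‖y i‖ ^ 2 := re_tsum_pairing_le' hy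
  -- `Σ' (|O|²/R + a − √2)|y|²` splits into the `B`-part and the deep tail `z ≥ 0`
  set z : AbcClassI.Idx → ℝ := fun i => if i ∈ HH ∪ HB then 0 else (onormSq i.1 / R + a - Real.sqrt 2) * ‖w i‖ ^ 2
    with hzdef
  have hz_nonneg : ∀ i, 0 ≤ z i := by
    intro i
    by_cases hi : i ∈ HH ∪ HB
    · simp only [hzdef, if_pos hi]; exact le_rfl
    · simp only [hzdef, if_neg hi]
      exact mul_nonneg (hR3 i (fun h => hi (Finset.mem_union_left _ h))).le (sq_nonneg _)
  have hEy_s : Summable fun i : AbcClassI.Idx => (onormSq i.1 / R + a - Real.sqrt 2) * ‖y i‖ ^ 2 :=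
    summable_coef_mul_norm_sq hy _ (1 / R + |a| + 2) (fun i => abs_tail_coef_le hR a i)
  have hEB_supp : ∀ i ∉ HB, (if i ∈ HB then (onormSq i.1 / R + a - Real.sqrt 2) * ‖w i‖ ^ 2 else 0) = 0 :=
    fun i hi => if_neg hi
  have hEsplit_pt : ∀ i, (onormSq i.1 / R + a - Real.sqrt 2) * ‖y i‖ ^ 2 =
      (if i ∈ HB then (onormSq i.1 / R + a - Real.sqrt 2) * ‖w i‖ ^ 2 else 0) + z i := by
    intro i
    by_cases hiH : i ∈ HH
    · have hiB : i ∉ HB := fun h => not_mem_HH_of_mem_HB hHH hHB h hiH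
      simp [hydef, hzdef, hiH, hiB]
    · by_cases hiB : i ∈ HB
      · simp [hydef, hzdef, hiH, hiB]
      · simp [hydef, hzdef, hiH, hiB]
  have hz_s : Summable z := by
    have h1 : Summable fun i => (if i ∈ HB then (onormSq i.1 / R + a - Real.sqrt 2) * ‖w i‖ ^ 2 else 0) :=
      summable_of_ne_finset_zero hEB_supp
    have := hEy_s.sub h1
    refine this.congr fun i => ?_
    rw [hEsplit_pt i]; ring
  have hEsplit : ∑' i, (onormSq i.1 / R + a - Real.sqrt 2) * ‖y i‖ ^ 2 =
      ∑ l : ↥HB, E l * ‖w l.1‖ ^ 2 + ∑' i, z i := by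
    rw [tsum_congr hEsplit_pt, (summable_of_ne_finset_zero hEB_supp).tsum_add hz_s, tsum_eq_sum hEB_supp,
      ← Finset.sum_coe_sort HB]
    congr 1
    refine Finset.sum_congr rfl fun l _ => ?_
    rw [if_pos l.2, hE]
  -- combine the diagonal piece and the pairing bound: `Re Σ'f1 + Re Σ'f3 ≤ −Σ'(|O|²/R + a − √2)|y|²`
  have hy2 : Summable fun i : AbcClassI.Idx => ‖y i‖ ^ 2 := summable_norm_sq_of_weighted hy
  have hqa_s : Summable fun i : AbcClassI.Idx => (onormSq i.1 / R + a) * ‖y i‖ ^ 2 := by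
    have := hEy_s.add (hy2.mul_left (Real.sqrt 2))
    refine this.congr fun i => ?_; ring
  have h13 : (∑' i, f1 i).re + (∑' i, f3 i).re ≤ -∑' i, (onormSq i.1 / R + a - Real.sqrt 2) * ‖y i‖ ^ 2 := by
    rw [hf1_re]
    have e : ∑' i, (onormSq i.1 / R + a - Real.sqrt 2) * ‖y i‖ ^ 2 =
        ∑' i, (onormSq i.1 / R + a) * ‖y i‖ ^ 2 - Real.sqrt 2 * ∑' i, ‖y i‖ ^ 2 := by
      rw [← tsum_mul_left, ← hqa_s.tsum_sub (hy2.mul_left _)]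
      exact tsum_congr fun i => by ring
    rw [e]; linarith
  -- the `B`-norms are `uB² + vB²`
  have hEB : ∑ l : ↥HB, E l * ‖w l.1‖ ^ 2 =
      ∑ l : ↥HB, E l * (fun l : ↥HB => (w l.1).re) l ^ 2 + ∑ l : ↥HB, E l * (fun l : ↥HB => (w l.1).im) l ^ 2 := by
    rw [← Finset.sum_add_distrib]
    refine Finset.sum_congr rfl fun l _ => ?_
    rw [Complex.sq_norm, Complex.normSq_apply]; ring
  -- assemble: `2 Re Σ'f ≤ bracket(u) + bracket(v) − 2 Σ' z`
  have hre : (∑' i, f i).re = (∑ i ∈ HH, f i + ∑ i ∈ HB, f2 i).re + (∑' i, f1 i).re + (∑' i, f3 i).re := by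
    rw [htsum]; simp only [Complex.add_re]; ring
  obtain ⟨hBu, hBu'⟩ := bracket_nonpos hHH hHB hR3 GH Ah AHB ABH E hE hR1
    (fun i : ↥HH => (w i.1).re) (fun l : ↥HB => (w l.1).re)
  obtain ⟨hBv, hBv'⟩ := bracket_nonpos hHH hHB hR3 GH Ah AHB ABH E hE hR1
    (fun i : ↥HH => (w i.1).im) (fun l : ↥HB => (w l.1).im)
  have hz_tsum_nonneg : 0 ≤ ∑' i, z i := tsum_nonneg hz_nonneg
  have hmain : 2 * (∑' i, f i).re ≤
      (((fun i : ↥HH => (w i.1).re) ⬝ᵥ ((GH * Ah + Ahᵀ * GH) *ᵥ fun i : ↥HH => (w i.1).re) +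
          2 * ((fun i : ↥HH => (w i.1).re) ⬝ᵥ ((GH * AHB + ABHᵀ) *ᵥ fun l : ↥HB => (w l.1).re)) -
          2 * ∑ l : ↥HB, E l * (fun l : ↥HB => (w l.1).re) l ^ 2) +
        ((fun i : ↥HH => (w i.1).im) ⬝ᵥ ((GH * Ah + Ahᵀ * GH) *ᵥ fun i : ↥HH => (w i.1).im) +
          2 * ((fun i : ↥HH => (w i.1).im) ⬝ᵥ ((GH * AHB + ABHᵀ) *ᵥ fun l : ↥HB => (w l.1).im)) -
          2 * ∑ l : ↥HB, E l * (fun l : ↥HB => (w l.1).im) l ^ 2)) -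
        2 * ∑' i, z i := by
    have h2 : 2 * (∑' i, f i).re = 2 * (∑ i ∈ HH, f i + ∑ i ∈ HB, f2 i).re +
        2 * ((∑' i, f1 i).re + (∑' i, f3 i).re) := by rw [hre]; ring
    rw [h2, hhead]
    have h3 := h13
    rw [hEsplit, hEB] at h3
    linarith
  -- case analysis: some head/shell coordinate is non-zero, or the deep tail carries `w`
  by_cases hcase : ((fun i : ↥HH => (w i.1).re) ≠ 0 ∨ (fun l : ↥HB => (w l.1).re) ≠ 0) ∨
      ((fun i : ↥HH => (w i.1).im) ≠ 0 ∨ (fun l : ↥HB => (w l.1).im) ≠ 0)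
  · rcases hcase with hu | hv
    · have := hBu' hu; linarith
    · have := hBv' hv; linarith
  · -- `w` vanishes on `H ∪ B`; since `w ≠ 0` the deep tail is strictly positive
    push Not at hcase
    obtain ⟨⟨huH, huB⟩, hvH, hvB⟩ := hcase
    have hwHB : ∀ i ∈ HH ∪ HB, w i = 0 := by
      intro i hi
      rcases Finset.mem_union.mp hi with hiH | hiB
      · apply Complex.ext
        · simpa using congrFun huH ⟨i, hiH⟩
        · simpa using congrFun hvH ⟨i, hiH⟩
      · apply Complex.ext
        · simpa using congrFun huB ⟨i, hiB⟩
        · simpa using congrFun hvB ⟨i, hiB⟩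
    obtain ⟨i₀, hi₀⟩ : ∃ i₀, w i₀ ≠ 0 := by
      by_contra h
      push Not at h
      exact hw0 (funext h)
    have hi₀HB : i₀ ∉ HH ∪ HB := fun h => hi₀ (hwHB i₀ h)
    have hzpos : 0 < ∑' i, z i := by
      refine hz_s.tsum_pos hz_nonneg i₀ ?_
      simp only [hzdef, if_neg hi₀HB]
      exact mul_pos (hR3 i₀ (fun h => hi₀HB (Finset.mem_union_left _ h))) (by positivity)
    linarith

end Form

end Summit.NavierStokesRegularity.FluidComputer.AbcInertiaCI

end
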